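import Summits.QuantumAdvantage.QuantumAdvantage.Theorems.ResponseDialI
import Literature.Computability.MetaComplexity.NWGenerator

/-!
# ResponseDial REV 2 delta (§14) — Theorems twin (tree landing, census lane decomp-qadv g10) of NODE «ResponseDial» REV 1 (2048310a…, 2756 l)

Verbatim content of the lens node file `run/shared/lean/pub/decomp-qadv/decomp-qadv-lens-2/g19/ResponseDial.lean` §14 under the (§1–§13 = tree parts ResponseDialA–I)
`Theorems.ResponseDial` namespace (the node elaborates under `Theses.ResponseDial`); the `#print axioms` guard block is dropped (the gate records axioms).
Supports stmt-QuantumAdvantage-27656 (`Theses.SparsityDial.DenseGenericLoss3`); `antipodalLoss3` closes the §5 rung `Theorems.SparsityDial.AntipodalLoss3` of the landed SparsityDial twin BY NAME.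

# NODE «ResponseDial» (decomp-qadv-lens-2, gen 19; RESIDUAL MODE on `SparsityDial.DenseGenericLoss3` = D, stmt-27656)

Lens: structural dichotomy (special vs generic).  Dial phrase (new in the lineage V1–V20): **additivity of the deviation
field's RESPONSE along adjacent-pair-flip orbits** — flip the five separated pairs `{b_i, b_i+1}` in every sub-pattern
`ε ∈ {0,1}^5`; the strategy's deviation set responds ADDITIVELY at `x` if `dev(x^ε) = dev(x) Δ (Δ_{i ∈ ε} R_i)` for some
response sets `R_i` (`AddResp`).  Pointer-type readers (`d_j = x_{a(j)} ⊕ junk-free`), and more generally every field whose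
deviation indicators are `𝔽₂`-affine in the input, respond additively at every input.

## What is PROVED here (0 sorry)
* §1–§2 **THE ADDITIVE-RESPONSE ORBIT LAW** (`additive_orbit_loses`, `additive_loss_count`): for EVERY strategy (no
  degree hypothesis), every admissible site tuple and every odd `x` at which the response is additive, one of the 32
  orbit points loses; hence `#{odd, additively responding} ≤ 32 · #{odd losers}`.  Mechanism: along the orbit the kernel
  phases move by `c_k(x^ε) = c_k(x) + Σ_{i∈ε, b_i<k} ±1` (`cN_orbF_cast`); the win condition at the 32 points is an
  `𝔽₂`-linear system in the unknown phase-class pattern sets whose all-win instance is INFEASIBLE — witnessed by 32 dual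
  certificates (`certN`, one per sign vector, found by Gaussian elimination, checked by `decide` through `CertOK`).
* §4 **the lineage's BC5 rung `SparsityDial.AntipodalLoss3` is now a THEOREM** (`antipodalLoss3`, loss `≥ 1/32`):
  the antipodal family responds additively everywhere (`apStrat_addResp`).
* §6 **the dial**: `StabAdd e P` (cheaply additivizable: some gauge of degree `≤ (log₂N)^e`, some site tuple, a.e. odd
  input responds additively); piece A `AddLoss3` (cheaply additivizable low-degree strategies lose `≥ n⁻¹`) is a THEOREM
  (`addLoss3`); piece B = the residual `NonAddGenericLoss3` (D restricted to `¬ StabAdd (c+1) P`);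
  `closes : AddLoss3 → NonAddGenericLoss3 → DenseGenericLoss3` and the exact converse; hence
  `nonAdd_iff_dense : NonAddGenericLoss3 ↔ DenseGenericLoss3` OUTRIGHT.
* §7 a CERTIFIED-DENSE member on which the law is silent: the HALF-COUNTER family `hcStrat` (antipodal pointer on
  `[1, N/2)`, canonical guess toggled by the common counter `[#{odd i : x_i} ≡ 0 (3)]` elsewhere; degree 4):
  `hcStrat_not_polylogSparse` (E1 transfers to every family agreeing with `apStrat` on the first half:
  `not_polylogSparse_of_agree`), `halfCounterLoss3_of_dense : D → HalfCounterLoss3` (the residual's first rung, OPEN);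
  §8 `hcStrat_not_addResp`: it responds NON-additively at EVERY input along EVERY admissible orbit (zero gauge);
  `apStrat_stabAdd`: the antipodal family IS cheaply additivizable — the dial cuts inside the dense class.

## Honest classification (NODE OUTPUT CONTRACT)
This is a **LAW node, not a certified split**: piece A is DECIDED, so the residual B is EQUIVALENT to the target
modulo the theorem (`nonAdd_iff_dense`) — B is not strictly weaker than D in implicational strength; it is SMALLER in
extension (the target class shrinks to the non-additivizable dense fields, and the whole `𝔽₂`-affine-response world,
incl. every pointer family the lineage has used as a witness, is removed by a theorem).  Per the critic's LAW/LADDER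
doctrine no child route is requested; the memo `NODE-g19.md` records the re-typed residual, the closed rung, the new
open rung `HalfCounterLoss3`, and the two open ENGINE questions (E3: is `hcStrat` additivizable by a non-zero cheap gauge —
the continuant automaton; CM: does the orbit-certificate method extend to common-mode mod-3 counter toggles at `F ≥ 8`). -/

set_option linter.dupNamespace false
noncomputable section
open scoped Classical

namespace Summit.QuantumAdvantage.QuantumAdvantage.Theorems.ResponseDial
open Finset
open Literature.Computability.QuantumComplexity Literature.Computability.QuantumComplexity.RingHLF
open Literature.Computability.MetaComplexity Literature.Computability.MetaComplexity.Smolensky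
open Summit.QuantumAdvantage.AdviceFreeQNC0
open Summit.QuantumAdvantage.QuantumAdvantage.Theorems.AnchorDial (outB dev cN orbF orbL orbL_cons fz
  cN_orbF_cast oddZeros_orbF win_iff gCond_iff_cN card_filter_orbF orbF_false flip2 card_odd_ge loss_shape_mono)
open Summit.QuantumAdvantage.QuantumAdvantage.Theorems.AnchorDial.Core (ct sg)
open Summit.QuantumAdvantage.QuantumAdvantage.Theorems.HolonomyDial (gCond tPoly tPoly_apply tPoly_mem card_odd_le
  xorP xorP_mem xorP_apply_bool mono_singleton_apply indP indP_mem indP_apply)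
open Summit.QuantumAdvantage.QuantumAdvantage.Theorems.StabilizerDial (apIdx apStrat apStrat_mem bitP bitP_apStrat
  pad rel_pad_iff outB_pad_zero pad_mem StabFew rowMask bitP_pad mem_dev_pad_apStrat_iff BlockRec
  blockSelect_of_fewLocus goodBound_of_blockRec fibreIdentityAt_of_block oddSliceBound_holds eventually_polylog
  side_bounds)
open Summit.QuantumAdvantage.QuantumAdvantage.Theorems.LocusDial (Coverable FewLocus)
open Summit.QuantumAdvantage.QuantumAdvantage.Theorems.SparsityDial (real_loss_of_frac AntipodalLoss3 stabFew_mono_mr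
  one_le_logpow)
open Summit.QuantumAdvantage.QuantumAdvantage.Theses.SparsityDial (DenseGenericLoss3)

/-! ## §14  BEYOND THE METHOD: window-counter families in general, and the PALEY-WINDOW family — the residual's first
RESPONSE-RICH named instance (rung `PaleyCounterLoss3`, UNDECIDED; `D` speaks about it: `windowCounterLoss3_of_dense`).
A WINDOW SYSTEM `W` gives every position a set of cells; the family `wStrat W` is the antipodal pointer on the first
half-cycle (so it is certified dense, `wStrat_not_polylogSparse`) and, at a second-half position `k`, the canonical guess
toggled by the mod-3 counter of the input over `W k`.  Interval windows (§11–§12) are DECIDED by the orbit-certificate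
method.  The PALEY windows `W k = {odd i : i + k is a square mod p}`, `p` the least prime `≥ N`, are RESPONSE-RICH:
for EVERY choice of five separated pair-flip sites, as `k` runs over the second half-cycle the five flipped odd cells meet
`W k` in ALL 32 sub-patterns, each ≈ `N/64` times (Weil's bound for the character sums `∑_k ∏_j χ(k + i_j)`; checked
exhaustively at `N = 1024` (7346/7346 placements: equal-spaced gaps 2–40 at all offsets incl. the start of the cycle and
the straddling ones, plus 2000 random) and `N = 4000` (7445/7445, minimal pattern multiplicity 33), scratch
`rich_paley.py`), and with all 32 sub-pattern counter types realised the orbit system has NO certificate at ANY datum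
(`rich_check.py` (1): 0/1024 (z, δ); 16 patterns in a hyperplane already give 0/1024).  So by the TYPE-SPAN criterion
(§13) no placement menu certifies this family: it is the first named member of `D`'s class beyond the reach of §1–§13,
and the engine that would decide it is a character-sum / second-moment equidistribution law, not an orbit certificate. -/

section Window
variable {N : ℕ}

/-- the counter of a window: the cells of `W k`, summed in `𝔽₃` (degree 1). -/
def loddG (W : Fin N → Finset (Fin N)) (k : Fin N) : CubeFn (ZMod 3) N := ∑ i ∈ W k, mono (ZMod 3) {i}

/-- ResponseDialJ helper `loddG_mem` (decomp-qadv land package; see the module docstring). -/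
theorem loddG_mem (W : Fin N → Finset (Fin N)) (k : Fin N) : loddG W k ∈ lowDeg (ZMod 3) N 1 :=
  Submodule.sum_mem _ fun _ _ => mono_mem_lowDeg (Finset.card_singleton _).le

/-- **the window-counter family of a window system** (degree 4): antipodal pointer on the first half-cycle, canonical
guess XOR `[counter over W k ≡ 0]` elsewhere. -/
def wStrat (W : Fin N → Finset (Fin N)) (k : Fin N) : CubeFn (ZMod 3) N :=
  if 1 ≤ k.val ∧ k.val < N / 2 then apStrat k else xorP (tPoly k) (indP (loddG W k) 0)

/-- ResponseDialJ helper `wStrat_mem` (decomp-qadv land package; see the module docstring). -/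
theorem wStrat_mem (W : Fin N → Finset (Fin N)) (k : Fin N) : wStrat W k ∈ lowDeg (ZMod 3) N 4 := by
  unfold wStrat
  split_ifs
  · exact lowDeg_mono (by norm_num) (apStrat_mem k)
  · have h : xorP (tPoly k) (indP (loddG W k) 0) ∈ lowDeg (ZMod 3) N (2 + 2) :=
      xorP_mem (tPoly_mem k) (indP_mem (loddG_mem W k) 0)
    exact lowDeg_mono (by norm_num) h

/-- ResponseDialJ helper `wStrat_agree` (decomp-qadv land package; see the module docstring). -/
theorem wStrat_agree (W : Fin N → Finset (Fin N)) (j : Fin N) (h1 : 1 ≤ j.val) (h2 : j.val < N / 2) :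
    wStrat W j = apStrat j := by
  unfold wStrat; rw [if_pos ⟨h1, h2⟩]

end Window

/-- CERTIFIED DENSE, uniformly in the window system: no window-counter family is cheaply `(log₂ n)^a`-point-sparsifiable. -/
theorem wStrat_not_polylogSparse (W : (n : ℕ) → Fin n → Finset (Fin n)) (a e : ℕ) :
    ∃ n₀ : ℕ, ∀ n ≥ n₀, ¬ StabFew ((Nat.log 2 n) ^ a) 0 e (fun j : Fin n => wStrat (W n) j) := by
  have hag : ∀ (n : ℕ) (j : Fin n), 1 ≤ j.val → j.val < n / 2 →
      (fun (n : ℕ) (j : Fin n) => (wStrat (W n) j : CubeFn (ZMod 3) n)) n j = apStrat j :=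
    fun n j h1 h2 => wStrat_agree (W n) j h1 h2
  obtain ⟨n₀, hn₀⟩ :=
    not_polylogSparse_of_agree (fun (n : ℕ) (j : Fin n) => (wStrat (W n) j : CubeFn (ZMod 3) n)) hag a e
  exact ⟨n₀, fun n hn => hn₀ n hn⟩

/-- ResponseDialJ helper `wStrat_in_dense_class` (decomp-qadv land package; see the module docstring). -/
theorem wStrat_in_dense_class (W : (n : ℕ) → Fin n → Finset (Fin n)) (a c : ℕ) (hc : 1 ≤ c) :
    ∃ n₀ : ℕ, ∀ n ≥ n₀, (∀ i : Fin n, wStrat (W n) i ∈ lowDeg (ZMod 3) n ((Nat.log 2 n) ^ c)) ∧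
      ¬ StabFew ((Nat.log 2 n) ^ a) 0 (c + 1) (fun j : Fin n => wStrat (W n) j) := by
  obtain ⟨n₀, hn₀⟩ := wStrat_not_polylogSparse W a (c + 1)
  refine ⟨max n₀ 16, fun n hn => ⟨fun i => ?_, hn₀ n (le_trans (le_max_left _ _) hn)⟩⟩
  have h16 : 2 ^ 4 ≤ n := le_trans (le_max_right _ _) hn
  have hL : 4 ≤ Nat.log 2 n := Nat.le_log_of_pow_le (by norm_num) h16
  have h4 : 4 ≤ (Nat.log 2 n) ^ c :=
    calc 4 ≤ Nat.log 2 n := hL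
      _ = (Nat.log 2 n) ^ 1 := (pow_one _).symm
      _ ≤ (Nat.log 2 n) ^ c := Nat.pow_le_pow_right (by omega) hc
  exact lowDeg_mono h4 (wStrat_mem (W n) i)

/-- the loss statement for the window-counter family of `W`. -/
def WindowCounterLoss3 (W : (n : ℕ) → Fin n → Finset (Fin n)) : Prop :=
  ∃ C n₀ : ℕ, ∀ n ≥ n₀,
    ((univ.filter fun x : Fin n → Bool => OddZeros x ∧ Rel x (fun i => decide (wStrat (W n) i x = 1))).card : ℝ)
      ≤ (1 - 1 / (n : ℝ) ^ C) * (2 : ℝ) ^ (n - 1)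

/-- `DenseGenericLoss3 ⟹ WindowCounterLoss3 W` for EVERY window system `W` (at `a = 1`, `c = 1`). -/
theorem windowCounterLoss3_of_dense (W : (n : ℕ) → Fin n → Finset (Fin n)) (hD : DenseGenericLoss3) :
    WindowCounterLoss3 W := by
  obtain ⟨a, C, h⟩ := hD
  obtain ⟨n₁, hn₁⟩ := h 1
  obtain ⟨n₂, hn₂⟩ := wStrat_in_dense_class W a 1 le_rfl
  refine ⟨C, max n₁ n₂, fun n hn => ?_⟩
  obtain ⟨hdeg, hgen⟩ := hn₂ n (le_trans (le_max_right _ _) hn)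
  exact hn₁ n (le_trans (le_max_left _ _) hn) _ hdeg hgen

/-- the PALEY WINDOW SYSTEM: at scale `n`, position `k` counts the odd cells `i` with `i + k` a square modulo the least
prime `p ≥ n` (`Literature.Computability.MetaComplexity.leastPrimeGe`, `n ≤ p ≤ 2n` by Bertrand). -/
noncomputable def paleyW (n : ℕ) (k : Fin n) : Finset (Fin n) := by
  classical
  exact univ.filter fun i : Fin n => i.val % 2 = 1 ∧
    ∃ r : ℕ, r < Literature.Computability.MetaComplexity.leastPrimeGe n ∧
      r * r % Literature.Computability.MetaComplexity.leastPrimeGe n =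
        (i.val + k.val) % Literature.Computability.MetaComplexity.leastPrimeGe n

/-- **the residual's RESPONSE-RICH rung** (UNDECIDED; outside the orbit-certificate method by the TYPE-SPAN criterion):
the Paley-window counter family loses a polynomial fraction of the odd class. -/
def PaleyCounterLoss3 : Prop := WindowCounterLoss3 paleyW

/-- `DenseGenericLoss3 ⟹ PaleyCounterLoss3`: the target speaks about the Paley family by name. -/
theorem paleyCounterLoss3_of_dense (hD : DenseGenericLoss3) : PaleyCounterLoss3 :=
  windowCounterLoss3_of_dense paleyW hD

/-- and the multi-counter family of §11 IS a window-counter family (interval windows), decided in §12 — the two named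
window systems sit on the two sides of the method's reach. -/
theorem mcStrat_eq_wStrat {N : ℕ} (k : Fin N) :
    mcStrat k = wStrat (fun k : Fin N =>
      (univ : Finset (Fin N)).filter fun i => i.val % 2 = 1 ∧ k.val - N / 2 ≤ i.val ∧ i.val < k.val) k := by
  unfold mcStrat wStrat loddG loddW; rfl



end Summit.QuantumAdvantage.QuantumAdvantage.Theorems.ResponseDial
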